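import Mathlib
import Literature.Analysis.FluidPDE.ClassicalSolution
import Literature.Analysis.FluidPDE.SpaceTimeCalculus
import Summits.NavierStokesRegularity.NavierStokesRegularity.Theorems.TautLoopKelvinTautLoopLawStepWeberTools
import Summits.NavierStokesRegularity.NavierStokesRegularity.Theorems.TautLoopKelvinTautLoopLawStepSixPointTools
import Summits.NavierStokesRegularity.NavierStokesRegularity.Theorems.TautLoopKelvinTautLoopLawStepFlowTaylorTools
import Summits.NavierStokesRegularity.NavierStokesRegularity.Theorems.TautLoopKelvinTautLoopLawStepOneStepToolsAux
import HarnessLib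

/-!
# Route `TautLoopKelvin`, crux `TautLoopLaw` (stmt-NavierStokesRegularity-15249), line
  `Sketch-ideas-r1k1` (Dini–Saks architecture) — tools stub `stub_tautLoopStepOneStepTools`

**One-step consistency of the "average then transport" splitting** against the Navier–Stokes
evolution, modulo an explicit gradient. Let `(u, p)` be a classical solution of Navier–Stokes
(viscosity `ν > 0`, zero force) on the slab `[s, s'] × ℝ³`, `τ = s' − s ≤ 1`, with
`‖Dᵏu‖ ≤ Bₖ` (`k ≤ 4`) and `u`, `Du`, `D²u` time-Lipschitz with constant `Bt`, and let `X` be the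
backward flow of `u` (`∂ᵣX = u(r, X)`, `X(s') = id`), `A = X(s)`. With the six-point average
`M g(y) = ⅙ Σᵢ (g(y + a eᵢ) + g(y − a eᵢ))`, `a = √(6ντ)` (so `a²/6 = ντ`), and the exact 1-form
transport `T g(x) = (DA(x))† g(A x)`, one has

  `T(M u(s))(x) − u(s', x) = ∇q(x) + O(K τ²)`,  `q = ∫ₛ^{s'} p(r, ·) dr − (τ/2) ‖u(s, ·)‖²`,

uniformly in `x`, with `K` depending only on `(ν, B₀, …, B₄, Bt)`. Mechanism (`U = u(s)`):
`M U = U + ντ ΔU + O(B₄ a⁴)` (`tautLoopSix_consistency`), `‖T g‖ ≤ ‖DA‖ ‖g‖`;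
`T U = U − τ [(DU) u(s') + (Du(s'))† U] + O(τ²)` (`tautLoopWeber_consistency` with the flow
Taylor estimates `A = id − τ u(s') + O(τ²)`, `DA = id − τ Du(s') + O(τ²)` of
`stub_tautLoopStepFlowTaylorTools`), and `u(s') = U + O(τ)`, `Du(s') = DU + O(τ)`;
`ντ T(ΔU) = ντ ΔU + O(τ²)` (`‖DA − id‖ = O(τ)`, `‖ΔU(Ax) − ΔU(x)‖ ≤ 3B₃ ‖Ax − x‖`); on the
other side `u(s') − U = τ (νΔU − (DU) U) − ∫ₛ^{s'} ∇p(r) dr + O(τ²)` (the momentum equation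
integrated in time, `tautLoopOne_time_remainder`), while `(DU)† U = ∇(½‖U‖²)` and
`∫ₛ^{s'} ∇p(r) dr = ∇ ∫ₛ^{s'} p(r) dr` (`tautLoopOne_gradient_potential`). The convective terms
`τ (DU) U` cancel and the two gradients make up `∇q`.

Folklore numerical analysis of splitting schemes for Navier–Stokes in the Weber–Kelvin
formulation (A. J. Chorin, *Numerical study of slightly viscous flow*, J. Fluid Mech. 57 (1973),
§2; A. J. Majda, A. L. Bertozzi, *Vorticity and Incompressible Flow* (2002), §1.6 and §3.4);
everything is proved from Mathlib and the sibling tools files of the line.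
-/

noncomputable section

open Set Function Filter Topology MeasureTheory intervalIntegral InnerProductSpace
  Literature.Analysis.FluidPDE
open ContinuousLinearMap (adjoint)
open scoped InnerProductSpace RealInnerProductSpace Laplacian ContDiff

namespace Summit.NavierStokesRegularity.NavierStokesRegularity.Theorems

set_option linter.dupNamespace false

local notation3 "E3" => EuclideanSpace ℝ (Fin 3)

/-- **Tools stub `stub_tautLoopStepOneStepTools`** (registered signature, verbatim): one-step
consistency of the "average then transport" splitting against the Navier–Stokes evolution,
modulo the explicit gradient `∇q`, `q = ∫ₛ^{s'} p(r, ·) dr − ((s' − s)/2) ‖u(s, ·)‖²`: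
`‖(DX(s)(x))† (M u(s))(X(s) x) − u(s', x) − ∇q(x)‖ ≤ K (s' − s)²` with `K = K(ν, B₀, …, B₄, Bt)`.
[folklore] -/
theorem stub_tautLoopStepOneStepTools : ∀ (ν B₀ B₁ B₂ B₃ B₄ Bt : ℝ), 0 < ν → 0 ≤ B₀ → 0 ≤ B₁ →
    0 ≤ B₂ → 0 ≤ B₃ → 0 ≤ B₄ → 0 ≤ Bt → ∃ K : ℝ, 0 ≤ K ∧
    ∀ (u : ℝ → EuclideanSpace ℝ (Fin 3) → EuclideanSpace ℝ (Fin 3))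
    (p : ℝ → EuclideanSpace ℝ (Fin 3) → ℝ)
    (X : ℝ → EuclideanSpace ℝ (Fin 3) → EuclideanSpace ℝ (Fin 3)) (s s' : ℝ), s < s' →
    s' - s ≤ 1 → Literature.Analysis.FluidPDE.IsClassicalNSSolutionOn (Set.Icc s s') ν 0 u p →
    Literature.Analysis.FluidPDE.IsSmoothSpaceTimeOn (Set.Icc s s') X →
    (∀ r ∈ Set.Icc s s', ∀ y, HasDerivWithinAt (fun r' => X r' y) (u r (X r y)) (Set.Icc s s') r) →
    (∀ y, X s' y = y) → (∀ r ∈ Set.Icc s s', ∀ x, ‖u r x‖ ≤ B₀) →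
    (∀ r ∈ Set.Icc s s', ∀ x, ‖fderiv ℝ (u r) x‖ ≤ B₁) →
    (∀ r ∈ Set.Icc s s', ∀ x, ‖iteratedFDeriv ℝ 2 (u r) x‖ ≤ B₂) →
    (∀ r ∈ Set.Icc s s', ∀ x, ‖iteratedFDeriv ℝ 3 (u r) x‖ ≤ B₃) →
    (∀ r ∈ Set.Icc s s', ∀ x, ‖iteratedFDeriv ℝ 4 (u r) x‖ ≤ B₄) →
    (∀ r ∈ Set.Icc s s', ∀ r' ∈ Set.Icc s s', ∀ x, ‖u r' x - u r x‖ ≤ Bt * |r' - r|) →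
    (∀ r ∈ Set.Icc s s', ∀ r' ∈ Set.Icc s s', ∀ x,
      ‖fderiv ℝ (u r') x - fderiv ℝ (u r) x‖ ≤ Bt * |r' - r|) →
    (∀ r ∈ Set.Icc s s', ∀ r' ∈ Set.Icc s s', ∀ x,
      ‖iteratedFDeriv ℝ 2 (u r') x - iteratedFDeriv ℝ 2 (u r) x‖ ≤ Bt * |r' - r|) →
    ∃ q : EuclideanSpace ℝ (Fin 3) → ℝ, Differentiable ℝ q ∧ ∀ x,
      ‖ContinuousLinearMap.adjoint (fderiv ℝ (X s) x) ((1 / 6 : ℝ) • (∑ i : Fin 3,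
        (u s (X s x + Real.sqrt (6 * ν * (s' - s)) • EuclideanSpace.single i (1:ℝ)) +
          u s (X s x - Real.sqrt (6 * ν * (s' - s)) • EuclideanSpace.single i (1:ℝ))))) -
        u s' x - gradient q x‖ ≤ K * (s' - s) ^ 2 := by
  intro ν B₀ B₁ B₂ B₃ B₄ Bt hν hB₀ hB₁ hB₂ hB₃ hB₄ hBt
  obtain ⟨KF, hKF0, hF⟩ := stub_tautLoopStepFlowTaylorTools B₀ B₁ B₂ Bt hB₀ hB₁ hB₂ hBt
  obtain ⟨KW, hKW0, hW⟩ :=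
    tautLoopWeber_consistency KF KF B₀ B₁ B₂ B₀ B₁ hKF0 hKF0 hB₀ hB₁ hB₂ hB₀ hB₁
  refine ⟨36 * KF * B₄ * ν ^ 2 + KW + (B₁ + B₀) * Bt + 3 * ν * (B₂ * (KF + B₁) + B₃ * KF) +
    (3 * ν + B₀ + B₁) * Bt, by positivity, ?_⟩
  intro u p X s s' hss' hτ1 hNS hX hXu hXs' hu0 hu1 hu2 hu3 hu4 hut hDut hD2ut
  have hτ0 : 0 ≤ s' - s := (sub_pos.2 hss').le
  have hs : s ∈ Set.Icc s s' := Set.left_mem_Icc.2 hss'.le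
  have hs' : s' ∈ Set.Icc s s' := Set.right_mem_Icc.2 hss'.le
  have hu := hNS.smooth_velocity
  have hp := hNS.smooth_pressure
  have hU4 : ContDiff ℝ 4 (u s) := (hu.contDiff_slice hs).of_le (by norm_cast)
  have hU3 : ContDiff ℝ 3 (u s) := hU4.of_le (by norm_num)
  have hU2 : ContDiff ℝ 2 (u s) := hU4.of_le (by norm_num)
  have hU1 : ContDiff ℝ 1 (u s) := hU4.of_le (by norm_num)
  have hw1 : ContDiff ℝ 1 (u s') := (hu.contDiff_slice hs').of_le (by norm_cast)
  have hA1 : ContDiff ℝ 1 (X s) := (hX.contDiff_slice hs).of_le (by norm_cast)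
  -- flow Taylor estimates at time `s`, and Weber consistency of the transport of `u s`
  obtain ⟨hXd, hXd2, hDX, hDX2, -⟩ :=
    hF u X s s' hss' hτ1 hu hX hXu hXs' hu0 hu1 hu2 hut hDut s hs
  have hWeb := hW (X s) (u s') (u s) (s' - s) hτ0 hτ1 hA1 hw1 hU2 hXd2 hDX2 (hu0 s hs)
    (hu1 s hs) (hu2 s hs) (hu0 s' hs') (hu1 s' hs')
  -- the potential `q`
  obtain ⟨hqd, hqg⟩ := tautLoopOne_gradient_potential hss' hp hU1 (s' - s)
  refine ⟨fun y => (∫ r in s..s', p r y) - (s' - s) / 2 * ‖u s y‖ ^ 2, hqd, fun x => ?_⟩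
  rw [hqg x]
  -- abbreviations
  set a : ℝ := Real.sqrt (6 * ν * (s' - s)) with ha
  set y : E3 := X s x with hy
  set L : E3 →L[ℝ] E3 := fderiv ℝ (X s) x with hL
  have ha0 : 0 ≤ a := Real.sqrt_nonneg _
  have ha2 : a ^ 2 / 6 = ν * (s' - s) := by
    rw [ha, Real.sq_sqrt (by positivity)]; ring
  have ha4 : a ^ 4 = 36 * ν ^ 2 * (s' - s) ^ 2 := by
    rw [show a ^ 4 = (a ^ 2) ^ 2 by ring, ha, Real.sq_sqrt (by positivity)]; ring
  -- (1) six-point consistency at `y`, transported by `L†`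
  have h6 := tautLoopSix_consistency (u s) a B₄ ha0 hU4 (hu4 s hs) y
  set m : E3 := (1 / 6 : ℝ) • (∑ i : Fin 3, (u s (y + a • EuclideanSpace.single i (1:ℝ)) +
    u s (y - a • EuclideanSpace.single i (1:ℝ)))) with hm
  have hE1 : ‖adjoint L m - adjoint L (u s y) - (ν * (s' - s)) • adjoint L (Δ (u s) y)‖ ≤
      36 * KF * B₄ * ν ^ 2 * (s' - s) ^ 2 := by
    have e : adjoint L (m - u s y - (a ^ 2 / 6) • Δ (u s) y) =
        adjoint L m - adjoint L (u s y) - (ν * (s' - s)) • adjoint L (Δ (u s) y) := by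
      rw [ha2]; simp only [map_sub, map_smul]
    rw [← e]
    refine ((adjoint L).le_opNorm _).trans ?_
    rw [ContinuousLinearMap.adjoint.norm_map]
    calc ‖L‖ * ‖m - u s y - (a ^ 2 / 6) • Δ (u s) y‖ ≤ KF * (B₄ * a ^ 4) :=
          mul_le_mul (hDX x) h6 (norm_nonneg _) hKF0
      _ = 36 * KF * B₄ * ν ^ 2 * (s' - s) ^ 2 := by rw [ha4]; ring
  -- (2) replacing `u s'` by `u s` in the first-order Weber term (time-Lipschitz bounds)
  have hE3 : ‖(s' - s) • (fderiv ℝ (u s) x (u s' x) + adjoint (fderiv ℝ (u s') x) (u s x)) -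
      (s' - s) • (fderiv ℝ (u s) x (u s x) + adjoint (fderiv ℝ (u s) x) (u s x))‖ ≤
      (B₁ + B₀) * Bt * (s' - s) ^ 2 := by
    have hτabs : |s' - s| = s' - s := abs_of_nonneg hτ0
    have e : (s' - s) • (fderiv ℝ (u s) x (u s' x) + adjoint (fderiv ℝ (u s') x) (u s x)) -
        (s' - s) • (fderiv ℝ (u s) x (u s x) + adjoint (fderiv ℝ (u s) x) (u s x)) =
        (s' - s) • (fderiv ℝ (u s) x (u s' x - u s x) +
          adjoint (fderiv ℝ (u s') x - fderiv ℝ (u s) x) (u s x)) := by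
      simp only [map_sub, sub_apply, smul_add, smul_sub]; abel
    rw [e, norm_smul, Real.norm_of_nonneg hτ0]
    have f1 : ‖fderiv ℝ (u s) x (u s' x - u s x)‖ ≤ B₁ * (Bt * (s' - s)) := by
      refine ((fderiv ℝ (u s) x).le_of_opNorm_le (hu1 s hs x) _).trans ?_
      rw [← hτabs]
      exact mul_le_mul_of_nonneg_left (hut s hs s' hs' x) hB₁
    have f2 : ‖adjoint (fderiv ℝ (u s') x - fderiv ℝ (u s) x) (u s x)‖ ≤
        Bt * (s' - s) * B₀ := by
      refine ((adjoint (fderiv ℝ (u s') x - fderiv ℝ (u s) x)).le_opNorm _).trans ?_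
      rw [ContinuousLinearMap.adjoint.norm_map, ← hτabs]
      exact mul_le_mul (hDut s hs s' hs' x) (hu0 s hs x) (norm_nonneg _) (by positivity)
    calc (s' - s) * ‖fderiv ℝ (u s) x (u s' x - u s x) +
          adjoint (fderiv ℝ (u s') x - fderiv ℝ (u s) x) (u s x)‖
        ≤ (s' - s) * (B₁ * (Bt * (s' - s)) + Bt * (s' - s) * B₀) :=
          mul_le_mul_of_nonneg_left (norm_add_le_of_le f1 f2) hτ0
      _ = (B₁ + B₀) * Bt * (s' - s) ^ 2 := by ring
  -- (3) transporting the Laplacian: `‖L†(ΔU(y)) − ΔU(x)‖ = O(s' - s)`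
  have hE4 : ‖(ν * (s' - s)) • (adjoint L (Δ (u s) y) - Δ (u s) x)‖ ≤
      3 * ν * (B₂ * (KF + B₁) + B₃ * KF) * (s' - s) ^ 2 := by
    have hLid : ‖L - ContinuousLinearMap.id ℝ E3‖ ≤ (KF + B₁) * (s' - s) := by
      have e : L - ContinuousLinearMap.id ℝ E3 =
          (L - (ContinuousLinearMap.id ℝ E3 - (s' - s) • fderiv ℝ (u s') x)) -
            (s' - s) • fderiv ℝ (u s') x := by abel
      rw [e]
      calc ‖L - (ContinuousLinearMap.id ℝ E3 - (s' - s) • fderiv ℝ (u s') x) -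
            (s' - s) • fderiv ℝ (u s') x‖ ≤ KF * (s' - s) ^ 2 + (s' - s) * B₁ := by
            refine norm_sub_le_of_le (hDX2 x) ?_
            rw [norm_smul, Real.norm_of_nonneg hτ0]
            exact mul_le_mul_of_nonneg_left (hu1 s' hs' x) hτ0
        _ ≤ (KF + B₁) * (s' - s) := by
            nlinarith [mul_nonneg (mul_nonneg hKF0 hτ0) (sub_nonneg.2 hτ1)]
    have hlap : ‖Δ (u s) y‖ ≤ 3 * B₂ := by
      have h := tautLoopOne_norm_laplacian_sub_le (u s) (fun _ => (0 : E3)) y y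
      rw [laplacian_const, iteratedFDeriv_const_of_ne two_ne_zero, Pi.zero_apply, Pi.zero_apply,
        sub_zero, sub_zero] at h
      exact h.trans (mul_le_mul_of_nonneg_left (hu2 s hs y) (by norm_num))
    have hlap2 : ‖Δ (u s) y - Δ (u s) x‖ ≤ 3 * (B₃ * (KF * (s' - s))) := by
      refine (tautLoopOne_norm_laplacian_sub_le (u s) (u s) y x).trans ?_
      refine mul_le_mul_of_nonneg_left ?_ (by norm_num)
      exact (tautLoopOne_norm_iteratedFDeriv_two_sub_le hU3 (hu3 s hs) x y).trans
        (mul_le_mul_of_nonneg_left (hXd x) hB₃)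
    rw [norm_smul, Real.norm_of_nonneg (mul_nonneg hν.le hτ0)]
    calc ν * (s' - s) * ‖adjoint L (Δ (u s) y) - Δ (u s) x‖
        ≤ ν * (s' - s) * ((KF + B₁) * (s' - s) * (3 * B₂) + 3 * (B₃ * (KF * (s' - s)))) :=
          mul_le_mul_of_nonneg_left ((tautLoopOne_adjoint_apply_sub_le L _ _).trans
            (add_le_add (mul_le_mul hLid hlap (norm_nonneg _) (by positivity)) hlap2))
            (mul_nonneg hν.le hτ0)
      _ = 3 * ν * (B₂ * (KF + B₁) + B₃ * KF) * (s' - s) ^ 2 := by ring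
  -- (4) the time side: the momentum equation integrated over `[s, s']`
  have hE5 := tautLoopOne_time_remainder hss' hν.le hB₁ hBt hNS hu0 hu1 hut hDut hD2ut x
  -- assembly: the convective terms cancel, the gradients make up `∇q`
  have key : adjoint L m - u s' x - ((∫ r in s..s', gradient (p r) x) -
      (s' - s) • adjoint (fderiv ℝ (u s) x) (u s x)) =
      (adjoint L m - adjoint L (u s y) - (ν * (s' - s)) • adjoint L (Δ (u s) y))
      + (adjoint L (u s y) - (u s x - (s' - s) • (fderiv ℝ (u s) x (u s' x) +
          adjoint (fderiv ℝ (u s') x) (u s x))))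
      - ((s' - s) • (fderiv ℝ (u s) x (u s' x) + adjoint (fderiv ℝ (u s') x) (u s x)) -
          (s' - s) • (fderiv ℝ (u s) x (u s x) + adjoint (fderiv ℝ (u s) x) (u s x)))
      + (ν * (s' - s)) • (adjoint L (Δ (u s) y) - Δ (u s) x)
      - (u s' x - u s x - (s' - s) • (ν • Δ (u s) x - fderiv ℝ (u s) x (u s x)) +
          ∫ r in s..s', gradient (p r) x) := by
    module
  rw [key]
  calc _ ≤ 36 * KF * B₄ * ν ^ 2 * (s' - s) ^ 2 + KW * (s' - s) ^ 2 +
        (B₁ + B₀) * Bt * (s' - s) ^ 2 + 3 * ν * (B₂ * (KF + B₁) + B₃ * KF) * (s' - s) ^ 2 +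
        (3 * ν + B₀ + B₁) * Bt * (s' - s) ^ 2 :=
        norm_sub_le_of_le (norm_add_le_of_le (norm_sub_le_of_le (norm_add_le_of_le hE1
          (hWeb x)) hE3) hE4) hE5
    _ = _ := by ring

end Summit.NavierStokesRegularity.NavierStokesRegularity.Theorems

end
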